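import Mathlib
import HarnessLib
import Summits.HubbardSuperconductivity.HubbardSuperconductivity.Theorems.KLProgrammeKLRegimeThinOverlapIncrementTelescopePieces
import Summits.HubbardSuperconductivity.HubbardSuperconductivity.Theorems.KLProgrammeKLRegimeTwoVolumeTowerTransferTnorm

/-!
# K3 VL child `KLRegimeVolumeLimitV17F2` (stmt-HubbardSuperconductivity-20440), located item #23 «W2-HALF-VL», THE TRANSFER BUNDLE OF THE SHALLOW STEPS BY
# NAME: `TransferWtData (klTowerTransfer (b·L) M β μ K_{m₀+d} (k+1)) … Λ_T C_w` with ONE constant `C_w` (absolute), for every step `k` whose telescope base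
# `m₀ ≥ 2(k+1)+5` lies in the door's window `4^{m₀}·U ≤ 4^{2(k+1)+d₀}`, and every rate `0 ≤ Λ_T ≤ Λ_{k+1}` with `Λ_T·4^{m₀+d} ≤ ρ_t`

Cell `gate-hubbard-kl`, seat p3 (g15), lead of #23.  The `Λ_T`-currency door `transferWtData_klTowerTransfer_flow_of_pieces_tn` (p617599) fed with the
«W2H-OVL» pieces `rowColSumTn_klReanalysis_sub_flow` (part 23; `χ i = C_T·4^{2(k+1)+5}·(ΣGfr+1)U/4^{m₀+i}`, `χ′ i = 2χ i`), the geometric sum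
`Σ_{i<d} (χ i + χ′ i) ≤ 4·C_T·4^{2(k+1)+5−m₀}·(ΣGfr+1)U ≤ 8·C_T`, and monotonicity of `TransferWtData` in its constant:

* `transferWtData_mono` — `TransferWtData T ed ed₁ Λ_T c → c ≤ c′ → TransferWtData T ed ed₁ Λ_T c′`;
* **`transferWtData_klTowerTransfer_flow_shallow (d₀)`** — `∃ C_w ≥ 1, ρ_t > 0` (absolute), the bundle at `K_{m₀+d}` with constant `C_w` (binders of the
  `_tn` door + `2(k+1)+5 ≤ m₀` + `Λ_T·4^{m₀+d} ≤ ρ_t`).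

For the top frame take `m₀ + d = n⋆`; with `Λ_T := Λ_tel ≤ ρ_t·4^{−n⋆}` (W2H-PIECES-SPEC §4) every shallow step `k` (`2(k+1)+5 ≤ n⋆`, `m₀ := 2(k+1)+5`, needs
`4^{2(k+1)+5}U ≤ 4^{2(k+1)+d₀}`, i.e. `d₀ ≥ 5`) is served with the k-UNIFORM constant `C_w`; the deep steps keep the part-4/`_at` doors.  No definitions, no sorry.
Nothing asserts any stub, K3, VL or superconductivity. [cite: BenfattoGiulianiMastropietro2006, §2.7 (2.70)–(2.71a), §3 (3.2)–(3.8)]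
-/

noncomputable section

namespace Summit.HubbardSuperconductivity.HubbardSuperconductivity.Theorems.TorusFourierL2

set_option linter.dupNamespace false -- summit = problem name (single-conjunct summit), D-0017

open Set Finset Literature.MathematicalPhysics.QuantumLattice Literature.MathematicalPhysics.QuantumLattice.BandSectorCounting
open Literature.MathematicalPhysics.QuantumLattice.FermiRG Literature.Probability.LatticeModels
open Summit.HubbardSuperconductivity.HubbardSuperconductivity.Theorems.DispersionFlow
open Summit.HubbardSuperconductivity.HubbardSuperconductivity.Theorems.KLRegimeSplit
open Summit.HubbardSuperconductivity.HubbardSuperconductivity.Theorems.KLProgrammeLegKernels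
open Summit.HubbardSuperconductivity.HubbardSuperconductivity.Theorems.PerturbedFermiCurve
open Summit.HubbardSuperconductivity.HubbardSuperconductivity.Theorems.EngineV8
open Summit.HubbardSuperconductivity.HubbardSuperconductivity.Theorems.TwoVolumeSource
open Summit.HubbardSuperconductivity.HubbardSuperconductivity.Theorems.TwoVolumeDefect
open Summit.HubbardSuperconductivity.HubbardSuperconductivity.Theorems.KLRegimeWick
open scoped Real

open Classical

/-- **`TransferWtData` is monotone in its constant.** [folklore] -/
theorem transferWtData_mono {b L Lf M N N₁ : ℕ} [NeZero L] [NeZero Lf]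
    {T : Matrix ((SpaceTimeIdx Lf M × SectorLeg N) × Fin 2) ((SpaceTimeIdx Lf M × SectorLeg N₁) × Fin 2) ℂ}
    {ed : ((SpaceTimeIdx Lf M × SectorLeg N) × Fin 2) ≃ (Fin 2 → Fin b) × ((SpaceTimeIdx L M × SectorLeg N) × Fin 2)}
    {ed₁ : ((SpaceTimeIdx Lf M × SectorLeg N₁) × Fin 2) ≃ (Fin 2 → Fin b) × ((SpaceTimeIdx L M × SectorLeg N₁) × Fin 2)} {ΛT cW cW' : ℝ}
    (h : TransferWtData T ed ed₁ ΛT cW) (hle : cW ≤ cW') : TransferWtData T ed ed₁ ΛT cW' where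
  ΛT_nonneg := h.ΛT_nonneg
  cW_nonneg := h.cW_nonneg.trans hle
  row x := (h.row x).trans hle
  col y' := (h.col y').trans hle
  cov := h.cov

/-- `Σ_{i<d} c/4^{m₀+i} ≤ (4/3)·c/4^{m₀}` for `c ≥ 0`. [folklore] -/
theorem sum_div_four_pow_le {c : ℝ} (hc : 0 ≤ c) (m₀ d : ℕ) :
    ∑ i ∈ range d, c / (4 : ℝ) ^ (m₀ + i) ≤ 4 / 3 * (c / (4 : ℝ) ^ m₀) := by
  have hgeo : ∑ i ∈ range d, ((1 : ℝ) / 4) ^ i ≤ 4 / 3 := by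
    have hs : Summable (fun i : ℕ => ((1 : ℝ) / 4) ^ i) := summable_geometric_of_lt_one (by norm_num) (by norm_num)
    have h := Summable.sum_le_tsum (range d) (fun i _ => by positivity) hs
    rw [tsum_geometric_of_lt_one (by norm_num) (by norm_num)] at h
    norm_num at h ⊢
    exact h
  have e : ∀ i, c / (4 : ℝ) ^ (m₀ + i) = c / (4 : ℝ) ^ m₀ * ((1 : ℝ) / 4) ^ i := fun i => by
    rw [pow_add, one_div_pow]; field_simp
  simp_rw [e, ← Finset.mul_sum]
  calc c / (4 : ℝ) ^ m₀ * ∑ i ∈ range d, ((1 : ℝ) / 4) ^ i ≤ c / (4 : ℝ) ^ m₀ * (4 / 3) := mul_le_mul_of_nonneg_left hgeo (by positivity)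
    _ = 4 / 3 * (c / (4 : ℝ) ^ m₀) := by ring

set_option maxHeartbeats 1600000 in -- long binder lists of the two doors
/-- **The transfer bundle of the shallow steps along the flow chain, by name** (see the module docstring).
[cite: BenfattoGiulianiMastropietro2006, §2.7 (2.70)–(2.71a), §3 (3.2)–(3.8)] -/
theorem transferWtData_klTowerTransfer_flow_shallow (dd : ℕ) :
    ∃ Cw ρt : ℝ, 1 ≤ Cw ∧ 0 < ρt ∧
      ∀ (G : GeoConsts) (P : SplitConsts) (R : RenConsts) (Qe : EngConsts) (cc : ℝ), R.WF2 → 0 < cc → cc ≤ EngineV8.klEngC₃6 P R →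
      ∀ μ ∈ klWindowC, ∀ U : ℝ, 0 < U → U ≤ min (EngineV8.klEngU₀3 P R cc) (1 / (R.Gfr 3 + 1)) →
      ∀ β : ℝ, klBetaMin ≤ β → β ≤ Real.exp (cc / U ^ 2) →
      ∀ (L M : ℕ) [NeZero L] [NeZero M], EngineV8.klEngL₃ β U ≤ L → EngineV8.klEngM₃ β U L ≤ M →
      ∀ m₀ d : ℕ, 1 ≤ m₀ → m₀ + d ≤ nScales β + 1 → HistP klPredsV17F2 L M G P Qe R β U μ 0 (m₀ + d) →
        ∀ (b : ℕ) [NeZero (b * L)], EngineV8.klEngL₃ β U ≤ b * L →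
        ∀ k : ℕ, 2 * (k + 1) + 5 ≤ m₀ → (4 : ℝ) ^ m₀ * U ≤ (4 : ℝ) ^ (2 * (k + 1) + dd) →
        ∀ ΛT : ℝ, 0 ≤ ΛT → ΛT ≤ klScale klE0 (k + 1) → ΛT * (4 : ℝ) ^ (m₀ + d) ≤ ρt →
          TransferWtData (klTowerTransfer (b * L) M β μ (klFlowFrameU L M β U μ (m₀ + d)) (k + 1))
            (klBlockEquivD L b M (k + 1)) (klBlockEquivD L b M k) ΛT Cw := by
  obtain ⟨Cr, hCr, hdoor⟩ := transferWtData_klTowerTransfer_flow_of_pieces_tn dd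
  obtain ⟨CT, ρt, hCT, hρt, hpieces⟩ := rowColSumTn_klReanalysis_sub_flow
  refine ⟨Cr + 8 * CT + 1, ρt, by linarith, hρt, ?_⟩
  intro G P R Qe cc hR2 hcc hcc6 μ hμ U hU hUle β hβmin hβc L M _ _ hL3 hM3 m₀ d hm1 hN hhist b _ hV3 k hkm hwin ΛT hΛT0 hΛTle hΛTρ
  have hRj : ∀ j, 0 ≤ R.Gfr j := EngineV8.gfr_nonneg_of_wf2 hR2
  set Gs : ℝ := (R.Gfr 0 + R.Gfr 1 + R.Gfr 2 + R.Gfr 3 + 1) * U with hGs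
  have hGs0 : 0 ≤ Gs := by rw [hGs]; have := hRj 0; have := hRj 1; have := hRj 2; have := hRj 3; positivity
  have hGs2 : Gs ≤ 2 := by
    have hGU : ∀ {j : ℕ}, j < 5 → R.Gfr j * U ≤ 1 / (2 : ℝ) ^ 120 := fun hj =>
      gfr_mul_le_of_le_klEngU₀3 P hU.le (hUle.trans (min_le_left _ _)) hj
    have hU1 : U ≤ 1 := ((hUle.trans (min_le_left _ _)).trans (EngineV8.klEngU₀3_le_two_pow P R cc)).trans (by norm_num)
    have h0 := hGU (j := 0) (by norm_num); have h1 := hGU (j := 1) (by norm_num); have h2 := hGU (j := 2) (by norm_num)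
    have h3 := hGU (j := 3) (by norm_num)
    have h120 : (1 : ℝ) / 2 ^ 120 ≤ 1 / 4 := by norm_num
    rw [hGs]; nlinarith only [h0, h1, h2, h3, h120, hU1, hU]
  -- the pieces
  set χ : ℕ → ℝ := fun i => CT * (4 : ℝ) ^ (2 * (k + 1) + 5) * Gs / (4 : ℝ) ^ (m₀ + i) with hχ
  have hχ0 : ∀ i, 0 ≤ χ i := fun i => by rw [hχ]; positivity
  have hp : ∀ i < d, ΛT * (4 : ℝ) ^ (m₀ + i) ≤ ρt := fun i hi => by
    refine le_trans ?_ hΛTρ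
    exact mul_le_mul_of_nonneg_left (pow_le_pow_right₀ (by norm_num) (by omega)) hΛT0
  have hP := fun i (hi : i < d) => hpieces G P R Qe cc hR2 hcc hcc6 μ hμ U hU hUle β hβmin hβc L M hL3 hM3 (m₀ + d) hN hhist (b * L) hV3 k (m₀ + i)
    (by omega) (by omega) ΛT hΛT0 (hp i hi)
  have hd := hdoor G P R Qe cc hR2 hcc hcc6 μ hμ U hU hUle β hβmin hβc L M hL3 hM3 m₀ d hm1 hN hhist b hV3 k (by omega) hwin ΛT hΛT0 hΛTle
    χ (fun i => 2 * χ i) (fun i _ => hχ0 i) (fun i _ => by have := hχ0 i; positivity)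
    (fun i hi X'' => by simpa only [hχ, hGs] using (hP i hi).1 X'')
    (fun i hi X' => by simpa only [hχ, hGs] using (hP i hi).2 X')
  -- the geometric sum
  refine transferWtData_mono hd ?_
  have hsum : ∑ i ∈ range d, (χ i + 2 * χ i) ≤ 8 * CT := by
    have e : ∀ i, χ i + 2 * χ i = (3 * (CT * (4 : ℝ) ^ (2 * (k + 1) + 5) * Gs)) / (4 : ℝ) ^ (m₀ + i) := fun i => by rw [hχ]; ring
    simp_rw [e]
    refine (sum_div_four_pow_le (by positivity) m₀ d).trans ?_
    have h45 : (4 : ℝ) ^ (2 * (k + 1) + 5) / (4 : ℝ) ^ m₀ ≤ 1 := by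
      rw [div_le_one (by positivity)]; exact pow_le_pow_right₀ (by norm_num) hkm
    calc 4 / 3 * (3 * (CT * (4 : ℝ) ^ (2 * (k + 1) + 5) * Gs) / (4 : ℝ) ^ m₀) = 4 * CT * Gs * ((4 : ℝ) ^ (2 * (k + 1) + 5) / (4 : ℝ) ^ m₀) := by
          field_simp
      _ ≤ 4 * CT * 2 * 1 := by
          have := mul_le_mul (mul_le_mul_of_nonneg_left hGs2 (by positivity : (0 : ℝ) ≤ 4 * CT)) h45 (by positivity) (by positivity)
          linarith
      _ = 8 * CT := by ring
  linarith

end Summit.HubbardSuperconductivity.HubbardSuperconductivity.Theorems.TorusFourierL2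

end
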